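import Literature.Barriers.NavierStokesRegularity.DiffeomorphismNonInvarianceFamily
import Literature.Barriers.NavierStokesRegularity.DiffeomorphismNonInvarianceTorusField
import Literature.Analysis.FunctionSpaces.TorusShearKoopman
import Literature.Analysis.FunctionSpaces.TorusTranslationEstimate
import HarnessLib

/-!
# Barrier family, part 3b: the PERIODIC witness (Clay (B) class) — on `𝕋³` the transversal shear gauge
# `x ↦ x − (sin 2πx₁/2π) e₀` conjugates the uniform stream `c e₁` to the smooth divergence-free
# finite-energy field `v_c = c e₁ − c cos(2πx₁) e₀`, which is not a Navier–Stokes / Euler velocity for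
# any pressure (Fushchich–Shtelen–Slavutsky 1991 §1 (1.2)–(1.3); Acheson 1990 §2.3 (2.9))

Family file of the barrier entry `DiffeomorphismNonInvariance` (catalogue `NavierStokesRegularity`,
D-0021; D-0090 NS-CLAIMS cell, salvage seat `ns-claims-salvage-p6`, METHOD LEVEL, everything PROVED),
namespace `…NavierStokesRegularity.DiffeoGauge`. Parts 1–2 (`…Family`, `…Gauge`) give the `ℝ³` witness
(a decay-free uniform stream, scope caveat (b) of the entry); this part removes the «infinite energy»
objection: the same mechanism inside the periodic, smooth, finite-energy class of problem (B).

* the gauge: `sineShift s = −sin(2πs)/(2π)` (so `x ↦ x + h(x₁)e₀` is part 1's `shearMap sineShift` on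
  `ℝ³`, `1`-periodic, hence a self-map of `𝕋³`: the tree's transversal shear `Torus.shearMap 0 1 P`
  with the `Torus.ShearProfile` `sineProfile = −h`, `shearMapLift_sineProfile : Torus.shearMapLift 0 1
  sineProfile = shearMap sineShift`);
* the conjugation identity at the level of lifts, `kolmo_proj_eq_pushforward`:
  `v_c (proj y) = pushforward (shearMap h) (shearMapInv h) (c e₁) y = c e₁ + c h′(y₁) e₀` for all
  `y ∈ ℝ³` (characters at lifted points, `Torus.mFourier_proj_eq_exp_sum`);
* the uniform stream `(c e₁, 0)` is a classical solution on `𝕋³ × S` for every `S`, `ν`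
  (`isClassicalNSSolutionOn_torusStream`), while by part 3a (`…TorusField`) `v_c` is a classical
  solution for NO pressure when `c ≠ 0`;
* `torus_gauge_conjugate_not_solution` packages (i)–(iii).

WHAT THIS IS NOT: not a claim about NS regularity or blow-up; not a claim about any author beyond the
typed locator.
-/

noncomputable section

open Set Function MeasureTheory UnitAddTorus
open scoped ContDiff RealInnerProductSpace

namespace Literature.Barriers.NavierStokesRegularity.DiffeoGauge

open Literature.Analysis.FunctionSpaces Literature.Analysis.FunctionSpaces.Torus

/-! ### The gauge: `v_c` is the conjugate of the uniform stream `c e₁` by the transversal shear of `𝕋³` -/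

/-- The displacement profile `h(s) = −sin(2πs)/(2π)` (smooth, `1`-periodic, `h′(s) = −cos(2πs)`); the
gauge is `x ↦ x + h(x₁) e₀`, i.e. the tree's torus shear map `Torus.shearMap 0 1 P` with
`P = −h = sin(2π·)/(2π)`. [folklore] -/
def sineShift (s : ℝ) : ℝ := -(Real.sin (2 * Real.pi * s) / (2 * Real.pi))

/-- `h′(s) = −cos(2πs)`. [folklore] -/
private theorem hasDerivAt_sineShift (s : ℝ) : HasDerivAt sineShift (-Real.cos (2 * Real.pi * s)) s := by
  have h1 : HasDerivAt (fun r : ℝ => 2 * Real.pi * r) (2 * Real.pi) s := by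
    simpa using (hasDerivAt_id s).const_mul (2 * Real.pi)
  have h2 := ((Real.hasDerivAt_sin (2 * Real.pi * s)).comp s h1).div_const (2 * Real.pi)
  have h3 := h2.neg
  refine h3.congr_deriv ?_
  field_simp

/-- The tree's torus shear profile `P(s) = sin(2πs)/(2π) = −h(s)` (smooth and `1`-periodic), so
that `Torus.shearMap 0 1 sineProfile` is the gauge as a self-map of `𝕋³` (the tree's transversal shear
`Torus.shearMap`). [folklore] -/
def sineProfile : Torus.ShearProfile where
  toFun s := Real.sin (2 * Real.pi * s) / (2 * Real.pi)
  periodic' s := by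
    show Real.sin (2 * Real.pi * (s + 1)) / (2 * Real.pi) = Real.sin (2 * Real.pi * s) / (2 * Real.pi)
    rw [mul_add, mul_one, Real.sin_add_two_pi]
  contDiff' := by fun_prop

/-- The planar lift of the torus gauge IS the `ℝ³` shear gauge of part 1 with profile `h`:
`Torus.shearMapLift 0 1 P = shearMap h`. [cite: FushchichShtelenSlavutsky1991, §1 eqs. (1.2)–(1.3) p. 971] -/
theorem shearMapLift_sineProfile :
    Torus.shearMapLift (0 : Fin 3) 1 sineProfile = shearMap sineShift := by
  funext y
  simp only [Torus.shearMapLift, shearMap, sineShift, sineProfile, neg_smul, sub_eq_add_neg]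

/-- **The conjugation identity, at the level of lifts**: the periodic bent stream `v_c` on `𝕋³`,
lifted to `ℝ³`, is the push-forward of the uniform stream `c e₁` by the (1-periodic) shear gauge
`x ↦ x + h(x₁) e₀` — `v_c(proj y) = (ψ_h)_*(c e₁)(y) = c e₁ + c h′(y₁) e₀ = c e₁ − c cos(2πy₁) e₀`.
[cite: FushchichShtelenSlavutsky1991, §1 eqs. (1.2)–(1.3) p. 971] -/
theorem kolmo_proj_eq_pushforward (c : ℝ) (y : EuclideanSpace ℝ (Fin 3)) :
    kolmo c (Torus.proj y) =
      pushforward (shearMap sineShift) (shearMapInv sineShift)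
        (fun _ : EuclideanSpace ℝ (Fin 3) => c • EuclideanSpace.single (1 : Fin 3) (1 : ℝ)) y := by
  have hd : Differentiable ℝ sineShift := fun s => (hasDerivAt_sineShift s).differentiableAt
  rw [pushforward_shearMap_const hd]
  dsimp only
  rw [(hasDerivAt_sineShift (y 1)).deriv]
  -- characters at the lifted point
  have e1 : mFourier f1 (Torus.proj y) = Complex.exp (2 * Real.pi * Complex.I * ((y 1 : ℝ) : ℂ)) := by
    rw [Torus.mFourier_proj_eq_exp_sum]; simp [f1, Fin.sum_univ_three]
  have e2 : mFourier (-f1) (Torus.proj y) = Complex.exp (2 * Real.pi * Complex.I * ((-(y 1) : ℝ) : ℂ)) := by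
    rw [Torus.mFourier_proj_eq_exp_sum]; simp [f1, Fin.sum_univ_three]
  have hre : ∀ r : ℝ, (Complex.exp (2 * Real.pi * Complex.I * (r : ℂ))).re = Real.cos (2 * Real.pi * r) := by
    intro r
    rw [Complex.exp_re]
    simp
  have him : ∀ r : ℝ, (Complex.exp (2 * Real.pi * Complex.I * (r : ℂ))).im = Real.sin (2 * Real.pi * r) := by
    intro r
    rw [Complex.exp_im]
    simp
  obtain ⟨⟨h00, h01, h02⟩, ⟨h10, h11, h12⟩, ⟨h20, h21, h22⟩⟩ := kolmoCoeff_apply c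
  ext i
  rw [kolmo, realTrigPoly_apply_coord, trigPoly_apply_coord, sum_kolmoFreq, mFourier_zero, e1, e2]
  fin_cases i
  · simp only [Fin.zero_eta, Fin.isValue, h00, h10, h20, Complex.add_re, Complex.mul_re,
      Complex.ofReal_re, Complex.ofReal_im, hre, him, PiLp.add_apply, PiLp.smul_apply,
      PiLp.single_apply]
    simp [Real.cos_neg, mul_comm]
    ring
  · simp only [Fin.mk_one, Fin.isValue, h01, h11, h21, PiLp.add_apply, PiLp.smul_apply,
      PiLp.single_apply]
    simp
  · simp only [Fin.reduceFinMk, Fin.isValue, h02, h12, h22, PiLp.add_apply, PiLp.smul_apply,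
      PiLp.single_apply]
    simp

/-! ### The uniform stream on `𝕋³` is an exact solution; its conjugate is not -/

/-- The uniform stream `u ≡ c e₁`, `p ≡ 0` is an unforced classical solution on `𝕋³ × S` for every
time set `S` and every `ν` (the rest state in a moving frame: Galilean invariance; every term of
the momentum equation vanishes). [cite: MajdaBertozziCUP2002, §1.2] -/
theorem isClassicalNSSolutionOn_torusStream (S : Set ℝ) (ν c : ℝ) :
    Torus.IsClassicalNSSolutionOn S ν 0
      (fun (_ : ℝ) (_ : UnitAddTorus (Fin 3)) => c • EuclideanSpace.single (1 : Fin 3) (1 : ℝ))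
      (fun (_ : ℝ) (_ : UnitAddTorus (Fin 3)) => (0 : ℝ)) where
  smooth_velocity := by
    unfold Torus.IsSmoothSpaceTimeOn Torus.stLift
    exact contDiffOn_const
  smooth_pressure := by
    unfold Torus.IsSmoothSpaceTimeOn Torus.stLift
    exact contDiffOn_const
  momentum := by
    intro t _ x
    have hl : Torus.liftAt (fun _ : UnitAddTorus (Fin 3) => c • EuclideanSpace.single (1 : Fin 3) (1 : ℝ)) x =
        fun _ => c • EuclideanSpace.single (1 : Fin 3) (1 : ℝ) := rfl
    have hl0 : Torus.liftAt (fun _ : UnitAddTorus (Fin 3) => (0 : ℝ)) x = fun _ => (0 : ℝ) := rfl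
    have h1 : Torus.timeDerivWithin S
        (fun (_ : ℝ) (_ : UnitAddTorus (Fin 3)) => c • EuclideanSpace.single (1 : Fin 3) (1 : ℝ)) t x = 0 := by
      simp [Torus.timeDerivWithin]
    have h2 : Torus.convect (fun _ : UnitAddTorus (Fin 3) => c • EuclideanSpace.single (1 : Fin 3) (1 : ℝ))
        (fun _ => c • EuclideanSpace.single (1 : Fin 3) (1 : ℝ)) x = 0 := by
      simp [Torus.convect, Torus.fderiv, hl]
    have h3 : Torus.laplacian
        (fun _ : UnitAddTorus (Fin 3) => c • EuclideanSpace.single (1 : Fin 3) (1 : ℝ)) x = 0 := by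
      simp [Torus.laplacian, hl]
    have h4 : Torus.gradient (fun _ : UnitAddTorus (Fin 3) => (0 : ℝ)) x = 0 := by
      simp [Torus.gradient, hl0, _root_.gradient]
    rw [h1, h2, h3]
    simp [h4]
  divFree := by
    intro t _ x
    simp [Torus.divergence, Torus.partialDeriv, Torus.lineDeriv]

/-- **THE PERIODIC WITNESS (Clay (B) class), packaged.** On `𝕋³ = (ℝ/ℤ)³`, for every real `ν`:
(i) the uniform stream `(c e₁, 0)` is an unforced classical solution on `[0, ∞)`; (ii) its conjugate
by the transversal shear gauge `x ↦ x − (sin 2πx₁/2π) e₀` (the tree's `Torus.shearMap 0 1 sineProfile`,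
whose planar lift is part 1's `shearMap sineShift`) is the periodic bent stream `v_c` — smooth,
divergence-free, with finite energy (a real trigonometric polynomial on three frequencies) — in the precise sense `v_c ∘ proj = (ψ_h)_*(c e₁)` on `ℝ³`; (iii) for `c ≠ 0`, `v_c`
is NOT a classical Navier–Stokes / Euler velocity on `𝕋³` for any pressure and any time set
containing `0`. So the gauge-transfer law fails inside the periodic, finite-energy, smooth class of
problem (B) as well, not only for the decay-free `ℝ³` witness of parts 1–2.
[cite: FushchichShtelenSlavutsky1991, §1 eqs. (1.2)–(1.3) p. 971] -/
theorem torus_gauge_conjugate_not_solution (ν : ℝ) {c : ℝ} (hc : c ≠ 0) :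
    Torus.IsClassicalNSSolutionOn (Ici 0) ν 0
        (fun (_ : ℝ) (_ : UnitAddTorus (Fin 3)) => c • EuclideanSpace.single (1 : Fin 3) (1 : ℝ))
        (fun (_ : ℝ) (_ : UnitAddTorus (Fin 3)) => (0 : ℝ)) ∧
      IsSmooth (kolmo c) ∧ IsDivFree (kolmo c) ∧
      (∀ y : EuclideanSpace ℝ (Fin 3), kolmo c (Torus.proj y) =
        pushforward (shearMap sineShift) (shearMapInv sineShift)
          (fun _ : EuclideanSpace ℝ (Fin 3) => c • EuclideanSpace.single (1 : Fin 3) (1 : ℝ)) y) ∧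
      Torus.shearMapLift (0 : Fin 3) 1 sineProfile = shearMap sineShift ∧
      ∀ q : ℝ → UnitAddTorus (Fin 3) → ℝ,
        ¬ Torus.IsClassicalNSSolutionOn (Ici 0) ν 0 (fun _ => kolmo c) q :=
  ⟨isClassicalNSSolutionOn_torusStream (Ici 0) ν c, isSmooth_kolmo c, isDivFree_kolmo c,
    kolmo_proj_eq_pushforward c, shearMapLift_sineProfile,
    fun q => not_isClassicalNSSolutionOn_kolmo (t := 0) (Set.mem_Ici.2 le_rfl) hc ν q⟩

end Literature.Barriers.NavierStokesRegularity.DiffeoGauge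

end
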